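import Literature.Analysis.SpecialFunctions.SpheroidalHarmonicShooting
import Literature.Analysis.Calculus.ScalarImplicitFunction
import HarnessLib

/-!
# Local eigenvalue branches of the `m`-spheroidal equation: real branches with slope in `(−1, 0)`
# and holomorphic germs

Topic `Literature/Analysis/SpecialFunctions` (namespace `Literature.Analysis.SpecialFunctions`),
continuing `SpheroidalHarmonicShooting.lean`. The shooting function `F(ν, κ) = q'(1; m, ν, κ)` of
the `m`-spheroidal equation (its zeros `ν` give the even angular eigenvalues
`λ = ν + m(m+1)` at spheroidicity `κ`; Shlapentokh-Rothman, CMP 329 (2014), §2 and App. B) is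
holomorphic on `ℂ²`, real on `ℝ²`, and non-degenerate (`∂F/∂ν ≠ 0`) at every real zero with
`0 < ∂F/∂κ : ∂F/∂ν < 1`. This file draws the local consequences:

* `shootRe m (ν, κ) = Re F(ν, κ)` on `ℝ²` is `C^∞` with partial derivatives `Re ∂F/∂ν`, `Re ∂F/∂κ`
  (`hasDerivAt_shootRe_nu/kappa`), and `F`, `∂F/∂ν`, `∂F/∂κ` are real on `ℝ²`;
* **real local branches** (`exists_realBranch`): through every real zero `(ν₀, κ₀)` passes a `C^∞`
  real curve `κ ↦ g(κ)` of zeros, `g(κ₀) = ν₀`, locally unique, with **slope `g'(κ₀) ∈ (−1, 0)`**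
  (the eigenvalue decreases in `κ` at rate `< 1`, SR Prop. B.3-type bound);
* **holomorphic germs** (`exists_holoBranch`): through every real zero passes a holomorphic curve
  `κ ↦ Λ(κ)` (`ContDiffAt ℂ ∞`) of zeros of `F` in `ℂ²`, locally unique — "we embed the eigenvalues
  into holomorphic curves `λ_{ml}(κ)`" (SR App. B).

Both are `Literature.Analysis.Calculus.exists_implicit_of_partial_ne_zero` (`𝕜 = ℝ`, `ℂ`).

## References

* Y. Shlapentokh-Rothman, Comm. Math. Phys. 329 (2014) 859–891, §2 (2.1), App. B
  (Props. B.1–B.3). Key `ShlapentokhRothman2014KleinGordon`.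
-/

noncomputable section

open Set Filter Metric Topology
open scoped ContDiff

namespace Literature.Analysis.SpecialFunctions

open Literature.Analysis.ODE Literature.Analysis.Calculus

variable (m : ℕ)

/-! ### Reality of the shooting function and of its partial derivatives on `ℝ²` -/

/-- The complex derivative of a function that is real on the real axis is real there: if
`HasDerivAt e e' ↑z` (over `ℂ`) and `(e ↑x).im = 0` for `x` near `z`, then `e'.im = 0`. [folklore] -/
theorem im_deriv_eq_zero_of_real {e : ℂ → ℂ} {e' : ℂ} {z : ℝ} (h : HasDerivAt e e' (z : ℂ))
    (hreal : ∀ᶠ x : ℝ in 𝓝 z, (e (x : ℂ)).im = 0) : e'.im = 0 := by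
  -- `x ↦ Re(−i e(x)) = Im e(x)` has real derivative `Re(−i e') = Im e'`, and is identically `0`
  have h2 : HasDerivAt (fun w ↦ -Complex.I * e w) (-Complex.I * e') (z : ℂ) := h.const_mul _
  have h3 : HasDerivAt (fun x : ℝ ↦ ((fun w ↦ -Complex.I * e w) (x : ℂ)).re) (-Complex.I * e').re z :=
    h2.real_of_complex
  have hzero : (fun x : ℝ ↦ ((fun w ↦ -Complex.I * e w) (x : ℂ)).re) =ᶠ[𝓝 z] fun _ ↦ (0 : ℝ) := by
    filter_upwards [hreal] with x hx
    simp [Complex.mul_re, hx]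
  have h4 : HasDerivAt (fun _ : ℝ ↦ (0 : ℝ)) (-Complex.I * e').re z := h3.congr_of_eventuallyEq hzero.symm
  have h5 : (-Complex.I * e').re = 0 := h4.unique (hasDerivAt_const z 0)
  simpa [Complex.mul_re] using h5

/-- `F(ν, κ) = q'(1)` is real for real `ν, κ`. [folklore] -/
theorem im_sphmDer_one_real (ν κ : ℝ) : (sphmDer m (ν : ℂ) (κ : ℂ) 1).im = 0 := by
  have h := im_sphmDer_ofReal (m := m) (ν := (ν : ℂ)) (κ := (κ : ℂ)) (Complex.ofReal_im ν) (Complex.ofReal_im κ)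
    (t := 1) (by norm_num)
  simpa using h

/-- `∂F/∂ν` is real on `ℝ²`. [folklore] -/
theorem im_sphmDerD_one_real (ν κ : ℝ) : (sphmDerD m (ν : ℂ) (κ : ℂ) 1).im = 0 := by
  refine im_deriv_eq_zero_of_real (e := fun ν' ↦ sphmDer m ν' (κ : ℂ) 1)
    (hasDerivAt_sphmDer_nu (m := m) (ν := (ν : ℂ)) (κ := (κ : ℂ)) (by norm_num)) ?_
  exact Eventually.of_forall fun x ↦ im_sphmDer_one_real m x κ

/-- `∂F/∂κ` is real on `ℝ²`. [folklore] -/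
theorem im_sphmDerK_one_real (ν κ : ℝ) : (sphmDerK m (ν : ℂ) (κ : ℂ) 1).im = 0 := by
  refine im_deriv_eq_zero_of_real (e := fun κ' ↦ sphmDer m (ν : ℂ) κ' 1)
    (hasDerivAt_sphmDer_kappa (m := m) (ν := (ν : ℂ)) (κ := (κ : ℂ)) (by norm_num)) ?_
  exact Eventually.of_forall fun x ↦ im_sphmDer_one_real m ν x

/-- **The real shooting function** `F_ℝ(ν, κ) = Re q'(1; m, ν, κ)` on `ℝ²` (equal to `F` there).
[cite: ShlapentokhRothman2014KleinGordon, App. B] -/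
def shootRe (m : ℕ) (q : ℝ × ℝ) : ℝ := (sphmDer m (q.1 : ℂ) (q.2 : ℂ) 1).re

/-- `F = F_ℝ` on `ℝ²` (as complex numbers). [folklore] -/
theorem sphmDer_one_eq_shootRe (ν κ : ℝ) : sphmDer m (ν : ℂ) (κ : ℂ) 1 = (shootRe m (ν, κ) : ℂ) :=
  Complex.ext (by simp [shootRe]) (by simp [im_sphmDer_one_real])

/-- A real zero of `F_ℝ` is a zero of `F`. [folklore] -/
theorem sphmDer_one_eq_zero_of_shootRe {ν κ : ℝ} (h : shootRe m (ν, κ) = 0) : sphmDer m (ν : ℂ) (κ : ℂ) 1 = 0 := by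
  rw [sphmDer_one_eq_shootRe, h, Complex.ofReal_zero]

/-- **`F_ℝ` is `C^∞` on `ℝ²`.** [cite: ShlapentokhRothman2014KleinGordon, App. B] -/
theorem contDiff_shootRe : ContDiff ℝ ∞ (shootRe m) := by
  have hP : ContDiff ℝ ∞ (fun p : ℂ × ℂ ↦ sphmDer m p.1 p.2 1) :=
    (contDiff_sphmDer_param m (t₀ := 1) (by norm_num) le_rfl).restrict_scalars ℝ
  have hE : ContDiff ℝ ∞ (fun q : ℝ × ℝ ↦ ((q.1 : ℂ), (q.2 : ℂ))) :=
    (Complex.ofRealCLM.contDiff.comp contDiff_fst).prodMk (Complex.ofRealCLM.contDiff.comp contDiff_snd)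
  exact Complex.reCLM.contDiff.comp (hP.comp hE)

/-- The `ν`-partial of `F_ℝ` is `Re ∂F/∂ν`. [folklore] -/
theorem hasDerivAt_shootRe_nu (ν κ : ℝ) :
    HasDerivAt (fun x : ℝ ↦ shootRe m (x, κ)) (sphmDerD m (ν : ℂ) (κ : ℂ) 1).re ν :=
  (hasDerivAt_sphmDer_nu (m := m) (ν := (ν : ℂ)) (κ := (κ : ℂ)) (by norm_num)).real_of_complex

/-- The `κ`-partial of `F_ℝ` is `Re ∂F/∂κ`. [folklore] -/
theorem hasDerivAt_shootRe_kappa (ν κ : ℝ) :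
    HasDerivAt (fun y : ℝ ↦ shootRe m (ν, y)) (sphmDerK m (ν : ℂ) (κ : ℂ) 1).re κ :=
  (hasDerivAt_sphmDer_kappa (m := m) (ν := (ν : ℂ)) (κ := (κ : ℂ)) (by norm_num)).real_of_complex

/-! ### Real local branches with slope in `(−1, 0)` -/

/-- **Real local branches of eigenvalues.** Through every real zero `(ν₀, κ₀)` of the shooting
function passes a `C^∞` real curve `g` of zeros: `g(κ₀) = ν₀`, `F_ℝ(g(κ), κ) = 0` for `κ` near
`κ₀`, every real zero near `(ν₀, κ₀)` lies on the graph, and the slope satisfies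
`g'(κ₀) ∈ (−1, 0)` — the eigenvalue `λ(κ) = g(κ) + m(m+1)` decreases in `κ` at rate `< 1`
(`shooting_slope_mem_Ioo`: `g' = −∂F/∂κ : ∂F/∂ν = −∫x²(1−x²)^m u² / ∫(1−x²)^m u²`).
SR, CMP 329 (2014), App. B (Props. B.1–B.3). [cite: ShlapentokhRothman2014KleinGordon, App. B] -/
theorem exists_realBranch {ν₀ κ₀ : ℝ} (h0 : shootRe m (ν₀, κ₀) = 0) :
    ∃ g : ℝ → ℝ, g κ₀ = ν₀ ∧ ContDiffAt ℝ ∞ g κ₀ ∧ (∀ᶠ κ in 𝓝 κ₀, shootRe m (g κ, κ) = 0) ∧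
      (∀ᶠ q in 𝓝 (ν₀, κ₀), shootRe m q = 0 → q.1 = g q.2) ∧
      ∃ ρ : ℝ, 0 < ρ ∧ ρ < 1 ∧ HasDerivAt g (-ρ) κ₀ := by
  have hF : sphmDer m (ν₀ : ℂ) (κ₀ : ℂ) 1 = 0 := sphmDer_one_eq_zero_of_shootRe m h0
  obtain ⟨ρ, hρ0, hρ1, hK, hDne⟩ :=
    shooting_slope_mem_Ioo (m := m) (ν := (ν₀ : ℂ)) (κ := (κ₀ : ℂ)) (Complex.ofReal_im ν₀) (Complex.ofReal_im κ₀) hF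
  set D : ℂ := sphmDerD m (ν₀ : ℂ) (κ₀ : ℂ) 1 with hD
  have hDim : D.im = 0 := im_sphmDerD_one_real m ν₀ κ₀
  have hDre : D.re ≠ 0 := by
    intro h
    exact hDne (Complex.ext h hDim)
  have hKre : (sphmDerK m (ν₀ : ℂ) (κ₀ : ℂ) 1).re = ρ * D.re := by
    rw [hK, Complex.mul_re, Complex.ofReal_re, Complex.ofReal_im, zero_mul, sub_zero]
  obtain ⟨g, hg0, hgC, hgz, hgu, hgd⟩ := exists_implicit_of_partial_ne_zero (𝕜 := ℝ) (p := (ν₀, κ₀))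
    (contDiff_shootRe m).contDiffAt (WithTop.coe_le_coe.2 le_top) (hasDerivAt_shootRe_nu m ν₀ κ₀) (hasDerivAt_shootRe_kappa m ν₀ κ₀) hDre h0
  refine ⟨g, hg0, hgC, hgz, hgu, ρ, hρ0, hρ1, ?_⟩
  have hval : -(sphmDerK m (ν₀ : ℂ) (κ₀ : ℂ) 1).re / D.re = -ρ := by
    rw [hKre]; field_simp
  rw [hval] at hgd
  exact hgd

/-! ### Holomorphic germs -/

/-- **Holomorphic eigenvalue germs.** Through every real zero `(ν₀, κ₀)` of `F` passes a curve
`Λ : ℂ → ℂ`, holomorphic (indeed `C^∞` over `ℂ`) at `κ₀`, with `Λ(κ₀) = ν₀`, `F(Λ(κ), κ) = 0` for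
complex `κ` near `κ₀`, and every zero of `F` in `ℂ²` near `(ν₀, κ₀)` lies on its graph — the
holomorphic eigenvalue curve `λ_{ml}(κ) = Λ(κ) + m(m+1)` of Shlapentokh-Rothman, CMP 329 (2014),
App. B ("we embed the eigenvalues into holomorphic curves"). [cite: ShlapentokhRothman2014KleinGordon, App. B] -/
theorem exists_holoBranch {ν₀ κ₀ : ℝ} (h0 : shootRe m (ν₀, κ₀) = 0) :
    ∃ Λ : ℂ → ℂ, Λ (κ₀ : ℂ) = (ν₀ : ℂ) ∧ ContDiffAt ℂ ∞ Λ (κ₀ : ℂ) ∧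
      (∀ᶠ κ in 𝓝 (κ₀ : ℂ), sphmDer m (Λ κ) κ 1 = 0) ∧
      (∀ᶠ q in 𝓝 ((ν₀ : ℂ), (κ₀ : ℂ)), sphmDer m q.1 q.2 1 = 0 → q.1 = Λ q.2) ∧
      HasDerivAt Λ (-(sphmDerK m (ν₀ : ℂ) (κ₀ : ℂ) 1) / sphmDerD m (ν₀ : ℂ) (κ₀ : ℂ) 1) (κ₀ : ℂ) := by
  have hF : sphmDer m (ν₀ : ℂ) (κ₀ : ℂ) 1 = 0 := sphmDer_one_eq_zero_of_shootRe m h0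
  have hDne : sphmDerD m (ν₀ : ℂ) (κ₀ : ℂ) 1 ≠ 0 :=
    (sphmDerD_one_ne_zero (m := m) (Complex.ofReal_im ν₀) (Complex.ofReal_im κ₀) hF).1
  have hC : ContDiffAt ℂ ∞ (fun p : ℂ × ℂ ↦ sphmDer m p.1 p.2 1) ((ν₀ : ℂ), (κ₀ : ℂ)) :=
    (contDiff_sphmDer_param m (t₀ := 1) (by norm_num) le_rfl).contDiffAt
  obtain ⟨Λ, hΛ0, hΛC, hΛz, hΛu, hΛd⟩ := exists_implicit_of_partial_ne_zero (𝕜 := ℂ) (p := ((ν₀ : ℂ), (κ₀ : ℂ)))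
    (f := fun p : ℂ × ℂ ↦ sphmDer m p.1 p.2 1) hC (WithTop.coe_le_coe.2 le_top)
    (hasDerivAt_sphmDer_nu (m := m) (by norm_num)) (hasDerivAt_sphmDer_kappa (m := m) (by norm_num)) hDne hF
  exact ⟨Λ, hΛ0, hΛC, hΛz, hΛu, hΛd⟩

end Literature.Analysis.SpecialFunctions

end
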